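import Literature.Analysis.FunctionSpaces.TorusClassicalNSDifferenceBalances
import Literature.Analysis.FunctionSpaces.TorusClassicalNSVStabilityFlux
import Literature.Analysis.ODE.LinearComparison
import HarnessLib

/-!
# `V`-stability of strong solutions on `T³` with integrable coefficients

Function-space support file (all results proved; no definitions, no named facts), sequel of
`TorusClassicalNSDifferenceBalances.lean` (energy and enstrophy identities for the difference
`w = u₁ − u₂` of two classical solutions with the same viscosity and force) and of
`TorusClassicalNSDifferenceSmoothing.lean` (`H¹` continuous dependence under SUP-NORM coefficient
bounds `‖u₁‖ ≤ M`, `‖∂ᵢu₂‖ ≤ Cᵢ`). Here the coefficients are those of the theory of strong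
solutions in three dimensions: only the enstrophies `‖∇u₁(t)‖₂², ‖∇u₂(t)‖₂² ≤ M₁` and the time
integral `∫ₐ^{a+τ} ‖Δu₂‖₂² ≤ Y` enter (Constantin–Foias 1988, Ch. 10, Thm. 10.2 with (10.7):
`|w(t)|² ≤ |w(0)|² exp ∫₀ᵗ (c/ν) ‖u₂‖ |Au₂|`, "since `u₂ ∈ L^∞(0,T;V) ∩ L²(0,T;D(A))` the integral is
finite"; the same Grönwall argument one level up, in `V`):

* `Torus.exists_h1_sub_flux_le` — the pointwise-in-time differential inequality: there is
  `K = K(d) ≥ 0` such that for `ν > 0` and smooth zero-mean `U₁, U₂ : T³ → ℝ³` with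
  `‖∇Uᵢ‖₂² ≤ M₁`, the sum `E' + V'` of the right-hand sides of the two difference balances
  (`E = ∫ ‖W‖²`, `V = ‖∇W‖₂²`, `W = U₁ − U₂`) is at most
  `K (√M₁ + ν⁻⁷M₁⁴ + ν⁻¹(M₁ + ‖ΔU₂‖₂²)) (E + V)` (the three flux bounds of
  `TorusClassicalNSVStabilityFlux`, the `‖ΔW‖₂²`-terms being absorbed by the dissipation);
* `Torus.IsClassicalNSSolutionOn.h1_sub_le_mul_of_integral_laplacian_sq_le` — **`V`-stability**:
  for `ν > 0`, `M₁, Y, τ > 0` there is `C = C(d, ν, M₁, Y, τ)` such that for any two classical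
  solutions on `[a, a + τ] × T³` (same viscosity and force, zero-mean slices) with
  `‖∇uᵢ(t)‖₂² ≤ M₁` on the interval and `∫ₐ^{a+τ} ‖Δu₂(s)‖₂² ds ≤ Y`,
  `∫ ‖w(t)‖² + ‖∇w(t)‖₂² ≤ C (∫ ‖w(a)‖² + ‖∇w(a)‖₂²)` for all `t ∈ [a, a + τ]` — Grönwall with
  the continuous integrable coefficient `β(s) = α + γ‖Δu₂(s)‖₂²`
  (`Literature.Analysis.ODE.le_linearComparison`), `C = exp(ατ + γY)`.

This is the continuous-dependence-in-`V` companion of the uniqueness of strong solutions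
(Robinson–Rodrigo–Sadowski 2016, §6.3 and Exercise 6.5), with constants uniform on sets of
solutions obeying the two a priori bounds — the form consumed by compactness / closing arguments
for the Navier–Stokes semiflow on bounded invariant sets of `V`.

## Mathlib / tree search

Tree (reused): the two difference balances
(`Torus.IsClassicalNSSolutionOn.hasDerivWithinAt_integral_norm_sq_sub`,
`….hasDerivWithinAt_gradNormSq_sub`), the flux bounds of `TorusClassicalNSVStabilityFlux`,
`Literature.Analysis.ODE.le_linearComparison` (variable-coefficient Grönwall),
`Torus.IsSmoothSpaceTimeOn.continuousOn_integral` (time continuity of `∫ ‖Δu₂‖²`); the pattern is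
`Torus.IsClassicalNSSolutionOn.h1_sub_le_mul_exp` (`TorusClassicalNSDifferenceSmoothing`, sup-norm
coefficients, constant-coefficient Grönwall). Searched `h1_sub_le`, `integral_laplacian`,
`VStability`, `linearComparison` under `FunctionSpaces/Torus*`, `FluidPDE/Torus*`: no estimate with
time-integrable coefficients for classical torus solutions. Mathlib:
`intervalIntegral.integral_mono_interval`, `intervalIntegral.integral_const(_mul)`.

## References

* P. Constantin, C. Foias, *Navier–Stokes Equations*, Univ. Chicago Press 1988, Ch. 10,
  Thm. 10.2, (10.7), Remark 10.3. [ConstantinFoiasNSE1988]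
* J. C. Robinson, J. L. Rodrigo, W. Sadowski, *The Three-Dimensional Navier–Stokes Equations.
  Classical theory*, CUP 2016, §6.3 (Thm. 6.10) and Exercise 6.5. [RobinsonRodrigoSadowski2016]
-/

open MeasureTheory Set Filter
open scoped InnerProductSpace ContDiff Topology

noncomputable section

namespace Literature.Analysis.FunctionSpaces

namespace Torus

variable {d : Type*} [Fintype d] [DecidableEq d]

/-! ## The pointwise differential inequality -/

set_option maxHeartbeats 400000 in
/-- **The differential inequality of `V`-stability.** On `T^d` with `card d = 3` there is
`K ≥ 0` such that for every `ν > 0`, every `M₁` and all smooth zero-mean `U₁, U₂ : T^d → ℝ^d` with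
`‖∇U₁‖₂², ‖∇U₂‖₂² ≤ M₁`, writing `W = U₁ − U₂`, `E = ∫ ‖W‖²`, `V = ‖∇W‖₂²`, the sum of the
right-hand sides of the two difference balances,
`(−2νV − 2∫⟪(W·∇)U₂, W⟫) + (−2ν‖ΔW‖₂² + 2∫⟪(U₁·∇)W + (W·∇)U₂, ΔW⟫)`, is at most
`K (√M₁ + ν⁻⁷M₁⁴ + ν⁻¹(M₁ + ‖ΔU₂‖₂²)) (E + V)`: the energy flux is `≤ 2C‖∇U₂‖₂ V`
(`abs_integral_inner_convect_self_le_gradNormSq`), and the two Laplacian pairings are absorbed by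
the dissipation `2ν‖ΔW‖₂²` (`abs_integral_inner_convect_laplacian_transport_le`,
`abs_integral_inner_convect_laplacian_stretching_le` with `ε = ν/2`) — Constantin–Foias'
`d/dt|w|² ≤ (c/ν)‖u₂‖|Au₂||w|²` one level up. [cite: ConstantinFoiasNSE1988, Ch. 10 Thm. 10.2 (10.7)] -/
theorem exists_h1_sub_flux_le (hd : Fintype.card d = 3) :
    ∃ K : ℝ, 0 ≤ K ∧ ∀ {ν M₁ : ℝ} {U₁ U₂ : UnitAddTorus d → EuclideanSpace ℝ d}, 0 < ν →
      IsSmooth U₁ → IsSmooth U₂ → HasZeroMean U₁ → HasZeroMean U₂ →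
      gradNormSq U₁ ≤ M₁ → gradNormSq U₂ ≤ M₁ →
      (-(2 * ν * gradNormSq (fun y => U₁ y - U₂ y)) -
          2 * ∫ x, ⟪convect (fun y => U₁ y - U₂ y) U₂ x, U₁ x - U₂ x⟫_ℝ) +
        (-(2 * ν * ∫ x, ‖laplacian (fun y => U₁ y - U₂ y) x‖ ^ 2) +
          2 * ∫ x, ⟪convect U₁ (fun y => U₁ y - U₂ y) x +
            convect (fun y => U₁ y - U₂ y) U₂ x, laplacian (fun y => U₁ y - U₂ y) x⟫_ℝ) ≤
      K * (Real.sqrt M₁ + (ν ^ 7)⁻¹ * M₁ ^ 4 + ν⁻¹ * (M₁ + ∫ x, ‖laplacian U₂ x‖ ^ 2)) *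
        ((∫ x, ‖U₁ x - U₂ x‖ ^ 2) + gradNormSq (fun y => U₁ y - U₂ y)) := by
  obtain ⟨C₁, hC₁0, hC₁⟩ := abs_integral_inner_convect_self_le_gradNormSq (d := d) hd
  obtain ⟨K_b, hKb0, hKb⟩ := abs_integral_inner_convect_laplacian_transport_le (d := d) hd
  obtain ⟨K_c, hKc0, hKc⟩ := abs_integral_inner_convect_laplacian_stretching_le (d := d) hd
  refine ⟨2 * C₁ + 256 * K_b + 4 * K_c, by positivity, ?_⟩
  intro ν M₁ U₁ U₂ hν hU₁ hU₂ hz₁ hz₂ hG₁ hG₂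
  have hWz : HasZeroMean (fun y => U₁ y - U₂ y) := by
    have e1 : ∫ x, U₁ x = 0 := hz₁
    have e2 : ∫ x, U₂ x = 0 := hz₂
    unfold HasZeroMean
    rw [integral_sub hU₁.integrable hU₂.integrable, e1, e2, sub_zero]
  have hWs : IsSmooth (fun y => U₁ y - U₂ y) := hU₁.sub hU₂
  set W : UnitAddTorus d → EuclideanSpace ℝ d := fun y => U₁ y - U₂ y with hW
  set E : ℝ := ∫ x, ‖U₁ x - U₂ x‖ ^ 2 with hE
  set G : ℝ := gradNormSq W with hG
  set L : ℝ := ∫ x, ‖laplacian W x‖ ^ 2 with hL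
  set L₂ : ℝ := ∫ x, ‖laplacian U₂ x‖ ^ 2 with hL₂
  set K : ℝ := 2 * C₁ + 256 * K_b + 4 * K_c with hK
  have hE0 : 0 ≤ E := integral_nonneg fun x => sq_nonneg _
  have hG0 : 0 ≤ G := gradNormSq_nonneg _
  have hL0 : 0 ≤ L := integral_nonneg fun x => sq_nonneg _
  have hL₂0 : 0 ≤ L₂ := integral_nonneg fun x => sq_nonneg _
  have hG₁0 : 0 ≤ gradNormSq U₁ := gradNormSq_nonneg _
  have hM₁ : 0 ≤ M₁ := hG₁0.trans hG₁
  have hν2 : 0 < ν / 2 := half_pos hν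
  have hν0 : ν ≠ 0 := hν.ne'
  -- (a) the energy flux
  have ha : |∫ x, ⟪convect W U₂ x, U₁ x - U₂ x⟫_ℝ| ≤ C₁ * G * Real.sqrt M₁ :=
    (hC₁ W U₂ hWs hU₂ hWz).trans
      (mul_le_mul_of_nonneg_left (Real.sqrt_le_sqrt hG₂) (mul_nonneg hC₁0 hG0))
  -- (b) the transport term against the Laplacian
  have hb : |∫ x, ⟪convect U₁ W x, laplacian W x⟫_ℝ| ≤
      ν / 2 * L + K_b * ((ν / 2) ^ 7)⁻¹ * M₁ ^ 4 * G := by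
    refine (hKb (ν / 2) hν2 U₁ W hU₁ hWs hz₁).trans (add_le_add le_rfl ?_)
    exact mul_le_mul_of_nonneg_right
      (mul_le_mul_of_nonneg_left (pow_le_pow_left₀ hG₁0 hG₁ 4) (by positivity)) hG0
  -- (c) the stretching term against the Laplacian
  have hc : |∫ x, ⟪convect W U₂ x, laplacian W x⟫_ℝ| ≤
      ν / 2 * L + K_c * (ν / 2)⁻¹ * (M₁ + L₂) * G := by
    refine (hKc (ν / 2) hν2 W U₂ hWs hU₂ hWz).trans (add_le_add le_rfl ?_)
    exact mul_le_mul_of_nonneg_right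
      (mul_le_mul_of_nonneg_left (add_le_add hG₂ le_rfl) (by positivity)) hG0
  have e7 : ((ν / 2) ^ 7)⁻¹ = 128 * (ν ^ 7)⁻¹ := by
    rw [div_pow, inv_div, div_eq_mul_inv]
    norm_num
  have e1 : (ν / 2)⁻¹ = 2 * ν⁻¹ := by
    rw [inv_div, div_eq_mul_inv]
  rw [e7] at hb
  rw [e1] at hc
  -- splitting the enstrophy pairing
  have hsplit : ∫ x, ⟪convect U₁ W x + convect W U₂ x, laplacian W x⟫_ℝ =
      (∫ x, ⟪convect U₁ W x, laplacian W x⟫_ℝ) + ∫ x, ⟪convect W U₂ x, laplacian W x⟫_ℝ := by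
    have i1 : Integrable (fun x => ⟪convect U₁ W x, laplacian W x⟫_ℝ) volume :=
      ((hU₁.convect hWs).inner hWs.laplacian).integrable
    have i2 : Integrable (fun x => ⟪convect W U₂ x, laplacian W x⟫_ℝ) volume :=
      ((hWs.convect hU₂).inner hWs.laplacian).integrable
    rw [← integral_add i1 i2]
    exact integral_congr_ae (ae_of_all _ fun x => inner_add_left _ _ _)
  rw [hsplit]
  -- bookkeeping
  have q0 := neg_abs_le (∫ x, ⟪convect W U₂ x, U₁ x - U₂ x⟫_ℝ)
  have q0b := le_abs_self (∫ x, ⟪convect U₁ W x, laplacian W x⟫_ℝ)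
  have q0c := le_abs_self (∫ x, ⟪convect W U₂ x, laplacian W x⟫_ℝ)
  have hK1 : 2 * C₁ ≤ K := by rw [hK]; linarith
  have hK2 : 256 * K_b ≤ K := by rw [hK]; linarith
  have hK3 : 4 * K_c ≤ K := by rw [hK]; linarith
  have hf1 : 0 ≤ Real.sqrt M₁ * G := mul_nonneg (Real.sqrt_nonneg _) hG0
  have hf2 : 0 ≤ (ν ^ 7)⁻¹ * M₁ ^ 4 * G := by positivity
  have hf3 : 0 ≤ ν⁻¹ * (M₁ + L₂) * G := by positivity
  have q1 : 2 * C₁ * (Real.sqrt M₁ * G) ≤ K * (Real.sqrt M₁ * G) :=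
    mul_le_mul_of_nonneg_right hK1 hf1
  have q2 : 256 * K_b * ((ν ^ 7)⁻¹ * M₁ ^ 4 * G) ≤ K * ((ν ^ 7)⁻¹ * M₁ ^ 4 * G) :=
    mul_le_mul_of_nonneg_right hK2 hf2
  have q3 : 4 * K_c * (ν⁻¹ * (M₁ + L₂) * G) ≤ K * (ν⁻¹ * (M₁ + L₂) * G) :=
    mul_le_mul_of_nonneg_right hK3 hf3
  have q4 : 0 ≤ K * (Real.sqrt M₁ + (ν ^ 7)⁻¹ * M₁ ^ 4 + ν⁻¹ * (M₁ + L₂)) * E :=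
    mul_nonneg (mul_nonneg (by positivity) (by positivity)) hE0
  have q5 : 0 ≤ ν * G := mul_nonneg hν.le hG0
  nlinarith [ha, hb, hc, q0, q0b, q0c, q1, q2, q3, q4, q5]

/-! ## `V`-stability -/

section Stability

variable {ν : ℝ}

/-- **`V`-stability of strong solutions on `T³` with integrable coefficients.** On `T^d` with
`card d = 3`, for `ν > 0` and numbers `M₁, Y` and `τ > 0` there is `C = C(d, ν, M₁, Y, τ)` such that:
for any two classical solutions `(u₁, p₁)`, `(u₂, p₂)` of the Navier–Stokes system on
`[a, a + τ] × T^d` with the same viscosity `ν` and force, zero-mean slices, enstrophies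
`‖∇u₁(t)‖₂², ‖∇u₂(t)‖₂² ≤ M₁` on the interval and `∫ₐ^{a+τ} ‖Δu₂(s)‖₂² ds ≤ Y`, the difference
`w = u₁ − u₂` obeys `∫ ‖w(t)‖² + ‖∇w(t)‖₂² ≤ C (∫ ‖w(a)‖² + ‖∇w(a)‖₂²)` for every `t ∈ [a, a + τ]`.
Proof: `Φ = E + V` has `Φ' ≤ β Φ` within `[a, a + τ]` with the continuous coefficient
`β(s) = K(√M₁ + ν⁻⁷M₁⁴ + ν⁻¹M₁) + Kν⁻¹‖Δu₂(s)‖₂²` (`exists_h1_sub_flux_le` and the two difference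
balances), so `Φ(t) ≤ Φ(a) exp ∫ₐᵗ β ≤ Φ(a) exp(ατ + Kν⁻¹Y)`
(`Literature.Analysis.ODE.le_linearComparison`) — the Grönwall argument of Constantin–Foias,
Thm. 10.2 ("since `u₂ ∈ L^∞(0,T;V) ∩ L²(0,T;D(A))` the integral is finite") in `V`.
[cite: ConstantinFoiasNSE1988, Ch. 10 Thm. 10.2 (10.7)] -/
theorem IsClassicalNSSolutionOn.h1_sub_le_mul_of_integral_laplacian_sq_le
    (hd : Fintype.card d = 3) (hν : 0 < ν) (M₁ Y τ : ℝ) (hτ : 0 < τ) :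
    ∃ C : ℝ, ∀ {a : ℝ} {f u₁ u₂ : ℝ → UnitAddTorus d → EuclideanSpace ℝ d}
      {p₁ p₂ : ℝ → UnitAddTorus d → ℝ},
      IsClassicalNSSolutionOn (Icc a (a + τ)) ν f u₁ p₁ → IsClassicalNSSolutionOn (Icc a (a + τ)) ν f u₂ p₂ →
      (∀ t ∈ Icc a (a + τ), HasZeroMean (u₁ t)) → (∀ t ∈ Icc a (a + τ), HasZeroMean (u₂ t)) →
      (∀ t ∈ Icc a (a + τ), gradNormSq (u₁ t) ≤ M₁) → (∀ t ∈ Icc a (a + τ), gradNormSq (u₂ t) ≤ M₁) →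
      (∫ s in a..(a + τ), (∫ x, ‖laplacian (u₂ s) x‖ ^ 2) ≤ Y) →
      ∀ t ∈ Icc a (a + τ), (∫ x, ‖u₁ t x - u₂ t x‖ ^ 2) + gradNormSq (fun y => u₁ t y - u₂ t y) ≤
        C * ((∫ x, ‖u₁ a x - u₂ a x‖ ^ 2) + gradNormSq (fun y => u₁ a y - u₂ a y)) := by
  obtain ⟨K, hK0, hK⟩ := exists_h1_sub_flux_le (d := d) hd
  set α : ℝ := K * (Real.sqrt M₁ + (ν ^ 7)⁻¹ * M₁ ^ 4 + ν⁻¹ * M₁) with hα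
  set γ : ℝ := K * ν⁻¹ with hγ
  refine ⟨Real.exp (α * τ + γ * Y), ?_⟩
  intro a f u₁ u₂ p₁ p₂ h₁ h₂ hz₁ hz₂ hG₁ hG₂ hY t ht
  set b : ℝ := a + τ with hb
  have hab : a < b := by rw [hb]; linarith
  have ha : a ∈ Icc a b := left_mem_Icc.2 hab.le
  have hU : UniqueDiffOn ℝ (Icc a b) := uniqueDiffOn_Icc hab
  have hM₁ : 0 ≤ M₁ := (gradNormSq_nonneg _).trans (hG₁ a ha)
  have hα0 : 0 ≤ α := by positivity
  have hγ0 : 0 ≤ γ := by positivity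
  -- the `H¹` energy of the difference and its derivative
  set Φ : ℝ → ℝ := fun s => (∫ x, ‖u₁ s x - u₂ s x‖ ^ 2) + gradNormSq (fun y => u₁ s y - u₂ s y)
    with hΦ
  set Φ' : ℝ → ℝ := fun s =>
    (-(2 * ν * gradNormSq (fun y => u₁ s y - u₂ s y)) -
      2 * ∫ x, ⟪convect (fun y => u₁ s y - u₂ s y) (u₂ s) x, u₁ s x - u₂ s x⟫_ℝ) +
    (-(2 * ν * ∫ x, ‖laplacian (fun y => u₁ s y - u₂ s y) x‖ ^ 2) +
      2 * ∫ x, ⟪convect (u₁ s) (fun y => u₁ s y - u₂ s y) x +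
        convect (fun y => u₁ s y - u₂ s y) (u₂ s) x, laplacian (fun y => u₁ s y - u₂ s y) x⟫_ℝ)
    with hΦ'
  have hΦd : ∀ s ∈ Icc a b, HasDerivWithinAt Φ (Φ' s) (Icc a b) s := fun s hs =>
    (h₁.hasDerivWithinAt_integral_norm_sq_sub h₂ hab hs).add (h₁.hasDerivWithinAt_gradNormSq_sub h₂ hab hs)
  have hΦ0 : ∀ s, 0 ≤ Φ s := fun s =>
    add_nonneg (integral_nonneg fun x => sq_nonneg _) (gradNormSq_nonneg _)
  -- the continuous integrable coefficient
  set L₂ : ℝ → ℝ := fun s => ∫ x, ‖laplacian (u₂ s) x‖ ^ 2 with hL₂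
  set β : ℝ → ℝ := fun s => α + γ * L₂ s with hβ
  have hφ : IsSmoothSpaceTimeOn (Icc a b) (fun s x => ‖laplacian (u₂ s) x‖ ^ 2) :=
    (h₂.smooth_velocity.laplacian hU).norm_sq ℝ
  have hL₂c : ContinuousOn L₂ (Icc a b) := hφ.continuousOn_integral (convex_Icc a b)
  have hL₂0 : ∀ s, 0 ≤ L₂ s := fun s => integral_nonneg fun x => sq_nonneg _
  have hβc : ContinuousOn β (Icc a b) := continuousOn_const.add (continuousOn_const.mul hL₂c)
  -- the differential inequality `Φ' ≤ β Φ`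
  have hbound : ∀ s ∈ Icc a b, Φ' s ≤ 0 + β s * Φ s := by
    intro s hs
    have h := hK hν (h₁.smooth_velocity.isSmooth_slice hs) (h₂.smooth_velocity.isSmooth_slice hs)
      (hz₁ s hs) (hz₂ s hs) (hG₁ s hs) (hG₂ s hs)
    have e : K * (Real.sqrt M₁ + (ν ^ 7)⁻¹ * M₁ ^ 4 + ν⁻¹ * (M₁ + ∫ x, ‖laplacian (u₂ s) x‖ ^ 2)) =
        β s := by
      simp only [hβ, hα, hγ, hL₂]
      ring
    simp only [hΦ', hΦ]
    rw [zero_add, ← e]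
    exact h
  -- Grönwall with the variable coefficient
  have hΦc : ContinuousOn Φ (Icc a b) := fun s hs => (hΦd s hs).continuousWithinAt
  have hΦr : ∀ s ∈ Ico a b, HasDerivWithinAt Φ (Φ' s) (Ici s) s := fun s hs =>
    ((hΦd s (Ico_subset_Icc_self hs)).mono (Icc_subset_Icc hs.1 le_rfl)).mono_of_mem_nhdsWithin
      (Icc_mem_nhdsGE hs.2)
  have hcmp := Literature.Analysis.ODE.le_linearComparison (A := fun _ => (0 : ℝ)) hΦc hΦr
    continuousOn_const hβc (fun s hs => hbound s (Ico_subset_Icc_self hs)) ht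
  simp only [zero_mul, intervalIntegral.integral_zero, add_zero] at hcmp
  -- the exponent: `∫ₐᵗ β ≤ ατ + γY`
  have hL₂i : IntervalIntegrable L₂ volume a t :=
    (hL₂c.mono (Icc_subset_Icc_right ht.2)).intervalIntegrable_of_Icc ht.1
  have hL₂i' : IntervalIntegrable L₂ volume a b := hL₂c.intervalIntegrable_of_Icc hab.le
  have hint : ∫ s in a..t, β s = α * (t - a) + γ * ∫ s in a..t, L₂ s := by
    simp only [hβ]
    rw [intervalIntegral.integral_add intervalIntegrable_const (hL₂i.const_mul γ),
      intervalIntegral.integral_const, intervalIntegral.integral_const_mul, smul_eq_mul]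
    ring
  have hmono : ∫ s in a..t, L₂ s ≤ Y := by
    calc ∫ s in a..t, L₂ s ≤ ∫ s in a..b, L₂ s :=
          intervalIntegral.integral_mono_interval le_rfl ht.1 ht.2
            (Eventually.of_forall fun s => hL₂0 s) hL₂i'
      _ ≤ Y := hY
  have hexp : ∫ s in a..t, β s ≤ α * τ + γ * Y := by
    rw [hint]
    have h1 : α * (t - a) ≤ α * τ := by
      refine mul_le_mul_of_nonneg_left ?_ hα0
      rw [hb] at ht
      linarith [ht.2]
    have h2 : γ * ∫ s in a..t, L₂ s ≤ γ * Y := mul_le_mul_of_nonneg_left hmono hγ0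
    linarith
  calc Φ t ≤ Real.exp (∫ s in a..t, β s) * Φ a := hcmp
    _ ≤ Real.exp (α * τ + γ * Y) * Φ a :=
        mul_le_mul_of_nonneg_right (Real.exp_le_exp.2 hexp) (hΦ0 a)

end Stability

end Torus

end Literature.Analysis.FunctionSpaces

end
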